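import Mathlib
import Literature.Analysis.ODE.PicardForcing
import Literature.Analysis.FluidPDE.Tao2016AveragedNS.ShiftSetCascadeFlows
import HarnessLib

/-!
# Shift-set pseudo-flows (`PseudoFlowOnShift 𝕊`): time-Lipschitz amplitudes, the defect Grönwall bound,
  horizon/defect monotonicity and the uniform a priori bounds (helper for item
  stmt-NavierStokesRegularity-22988 `GappedFrontRobustV2Flat`, crux K_B♭ of route TaoLadderRungTwoFlat)

The `𝕊`-parametrised versions, for an ARBITRARY shift set `𝕊`, of the format-independent tools of
`Theorems/TaoLadderRungThreeGappedFrontRobustStepTransfer.lean` (p1 g9, there for Tao's one-way shift set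
`S` and `TaoCascade.PseudoFlowOn`): the proofs are verbatim with `quadTerm ↦ quadTermOn 𝕊` and
`PseudoFlowOn ↦ PseudoFlowOnShift 𝕊` (tree module `ShiftSetCascadeFlows`), since none of them looks inside
the nonlinearity. (`stepTo_transfer` of that file is table-free and is reused as is for `𝕊 = shiftSetFlat`.)

* `pseudoFlowOnShift_abs_derivWithin_le`, `pseudoFlowOnShift_abs_sub_le` — amplitudes are Lipschitz in
  time with constant `sup (|quadTermOn| + κ₁ (1+ε₀)^{2k} √F)` ((4.8), mean value inequality);
* `pseudoFlowOnShift_energy_le_exp` — DEFECT GRÖNWALL: `½S² ≤ Ā` on `[0,s]` ⇒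
  `F ≤ (Ā + B₀) exp(κ₂ (1+ε₀)^{2k} u)` ((4.10) + the tree's integral Grönwall lemma);
* `pseudoFlowOnShift_mono` (shorter horizon), `pseudoFlowOnShift_of_le_defects` (larger defect constants),
  `pseudoFlowOnShift_uniform_bounds` (the constants of (4.5) merged).

HONEST FRAMING: elementary bookkeeping about Tao-type MODEL lattice pseudo-flows on a general shift set
(Tao 2016 §4 Lemma 4.1 (4.5), (4.8), (4.10); §6.4 Prop. 6.5 shape); nothing here is a statement about the
Navier–Stokes equations, and nothing is asserted about any table. Authored by the K_B₂ prover (p1 g11) as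
the first, table-generic layer of the S♭ port of K_B₂.
-/

noncomputable section

-- the sub-problem namespace `Summit.NavierStokesRegularity.NavierStokesRegularity` repeats the summit name by design (D-0017)
set_option linter.dupNamespace false

namespace Summit.NavierStokesRegularity.NavierStokesRegularity.Theorems

open Set MeasureTheory intervalIntegral Literature.Analysis.FluidPDE Literature.Analysis.FluidPDE.TaoCascade

namespace GappedFrontRobustOn

variable {m : ℕ}

variable {𝕊 : Finset (ℤ × ℤ × ℤ)} {τ ε₀ : ℝ} {α : Fin m → Fin m → Fin m → ℤ × ℤ × ℤ → ℝ} {κ₁ κ₂ : ℝ}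
  {S₀ F₀ B₀ : Fin m → ℤ → ℝ} {S F : Fin m → ℤ → ℝ → ℝ}

/-! ### Amplitudes are Lipschitz in time -/

/-- **The one-sided time derivative of an amplitude is bounded by the quadratic term plus the defect**:
`|∂S_{i,k}(u)| ≤ |quadTerm(S)_{i,k}(u)| + κ₁ (1+ε₀)^{2k} √F_{i,k}(u)` on `[0, τ]` ((4.8)).
[cite: Tao2016AveragedNS, §4 Lemma 4.1 (4.8)] -/
theorem pseudoFlowOnShift_abs_derivWithin_le (h : PseudoFlowOnShift 𝕊 τ ε₀ α κ₁ κ₂ S₀ F₀ B₀ S F) (i : Fin m)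
    (k : ℤ) {u : ℝ} (hu : u ∈ Icc 0 τ) :
    |derivWithin (S i k) (Icc 0 τ) u| ≤
      |quadTermOn 𝕊 ε₀ α S i k u| + κ₁ * (1 + ε₀) ^ ((2 : ℝ) * k) * Real.sqrt (F i k u) := by
  have h1 := h.motion i k u hu
  have h2 := abs_sub_abs_le_abs_sub (derivWithin (S i k) (Icc 0 τ) u) (quadTermOn 𝕊 ε₀ α S i k u)
  linarith

/-- **Amplitudes of a pseudo-flow are Lipschitz in time.** If
`|quadTerm(S)_{i,k}(u)| + κ₁ (1+ε₀)^{2k} √F_{i,k}(u) ≤ L` on `[0, τ]`, then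
`|S_{i,k}(t) − S_{i,k}(s)| ≤ L |t − s|` for `s, t ∈ [0, τ]` (mean value inequality for the derivative
within `[0, τ]`). [cite: Tao2016AveragedNS, §4 Lemma 4.1 (4.5), (4.8)] -/
theorem pseudoFlowOnShift_abs_sub_le (h : PseudoFlowOnShift 𝕊 τ ε₀ α κ₁ κ₂ S₀ F₀ B₀ S F)
    (i : Fin m) (k : ℤ) {L : ℝ}
    (hL : ∀ u ∈ Icc 0 τ,
      |quadTermOn 𝕊 ε₀ α S i k u| + κ₁ * (1 + ε₀) ^ ((2 : ℝ) * k) * Real.sqrt (F i k u) ≤ L)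
    {s t : ℝ} (hs : s ∈ Icc 0 τ) (ht : t ∈ Icc 0 τ) :
    |S i k t - S i k s| ≤ L * |t - s| := by
  have hdiff : DifferentiableOn ℝ (S i k) (Icc 0 τ) :=
    (h.contDiffOn_S i k).differentiableOn one_ne_zero
  have hbound : ∀ x ∈ Icc 0 τ, ‖derivWithin (S i k) (Icc 0 τ) x‖ ≤ L := fun x hx => by
    rw [Real.norm_eq_abs]
    exact (pseudoFlowOnShift_abs_derivWithin_le h i k hx).trans (hL x hx)
  have := (convex_Icc 0 τ).norm_image_sub_le_of_norm_derivWithin_le hdiff hbound hs ht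
  simpa only [Real.norm_eq_abs] using this

/-! ### The defect Grönwall bound for energies -/

/-- **DEFECT GRÖNWALL.** Along a pseudo-flow on `[0, τ]` with slack constant `κ₂ ≥ 0` (`ε₀ > −1`), if the
kinetic part is bounded on an initial segment, `½ S_{i,k}(u)² ≤ Ā` for `u ∈ [0, s]` (`s ≤ τ`), then
`F_{i,k}(u) ≤ (Ā + B₀_{i,k}) exp(κ₂ (1+ε₀)^{2k} u)` for `u ∈ [0, s]`: by (4.10),
`F ≤ ½S² + B₀ + κ₂ (1+ε₀)^{2k} ∫₀ F ≤ (Ā + B₀) + κ₂ (1+ε₀)^{2k} ∫₀ F`, and the integral Grönwall lemma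
applies. [cite: Tao2016AveragedNS, §4 Lemma 4.1 (4.10)] -/
theorem pseudoFlowOnShift_energy_le_exp (h : PseudoFlowOnShift 𝕊 τ ε₀ α κ₁ κ₂ S₀ F₀ B₀ S F) (hε : 0 < 1 + ε₀)
    (hκ₂ : 0 ≤ κ₂) (i : Fin m) (k : ℤ) {s Ā : ℝ} (hs : s ∈ Icc 0 τ)
    (hA : ∀ u ∈ Icc 0 s, (1 / 2) * S i k u ^ 2 ≤ Ā) :
    ∀ u ∈ Icc 0 s, F i k u ≤ (Ā + B₀ i k) * Real.exp (κ₂ * (1 + ε₀) ^ ((2 : ℝ) * k) * u) := by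
  have hsubI : Icc 0 s ⊆ Icc 0 τ := Icc_subset_Icc_right hs.2
  have hFc : ContinuousOn (F i k) (Icc 0 s) := (h.contDiffOn_F i k).continuousOn.mono hsubI
  have hK : 0 ≤ κ₂ * (1 + ε₀) ^ ((2 : ℝ) * k) := mul_nonneg hκ₂ (Real.rpow_pos_of_pos hε _).le
  have hineq : ∀ u ∈ Icc 0 s, F i k u ≤ (Ā + B₀ i k) +
      κ₂ * (1 + ε₀) ^ ((2 : ℝ) * k) * ∫ v in (0 : ℝ)..u, F i k v := by
    intro u hu
    have h1 := h.defect_upper i k u (hsubI hu)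
    have h2 := hA u hu
    linarith
  exact Literature.Analysis.ODE.le_mul_exp_of_le_add_mul_integral_Icc hFc hK hineq

/-! ### Structural lemmas: shrinking the horizon, enlarging the defect constants, the uniform bound (4.5) -/

/-- **Shrinking the horizon**: a pseudo-flow on `[0, τ]` is a pseudo-flow on `[0, τ']` for
`0 < τ' ≤ τ`, with the same table, defect constants, start data and slack (the one-sided derivatives
within `[0, τ']` and `[0, τ]` agree on `[0, τ']`, tree lemma `derivWithin_Icc_eq_derivWithin_Icc`).
Used to put the exact flow (horizon `c`) and a pseudo-flow (horizon `τ ≥ c`) on the common window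
`[0, τ₁]` of a step. [cite: Tao2016AveragedNS, §4 Lemma 4.1 (4.5), (4.8)–(4.10)] -/
theorem pseudoFlowOnShift_mono (h : PseudoFlowOnShift 𝕊 τ ε₀ α κ₁ κ₂ S₀ F₀ B₀ S F) {τ' : ℝ} (hτ' : 0 < τ')
    (hle : τ' ≤ τ) : PseudoFlowOnShift 𝕊 τ' ε₀ α κ₁ κ₂ S₀ F₀ B₀ S F where
  contDiffOn_S i k := (h.contDiffOn_S i k).mono (Icc_subset_Icc_right hle)
  contDiffOn_F i k := (h.contDiffOn_F i k).mono (Icc_subset_Icc_right hle)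
  nonneg_F i k s hs := h.nonneg_F i k s ⟨hs.1, hs.2.trans hle⟩
  apriori_S := by
    obtain ⟨M, hM⟩ := h.apriori_S
    exact ⟨M, fun s hs i k => hM s ⟨hs.1, hs.2.trans hle⟩ i k⟩
  apriori_F := by
    obtain ⟨M, hM⟩ := h.apriori_F
    exact ⟨M, fun s hs i k => hM s ⟨hs.1, hs.2.trans hle⟩ i k⟩
  init_S := h.init_S
  init_F := h.init_F
  motion i k s hs := by
    rw [derivWithin_Icc_eq_derivWithin_Icc (h.contDiffOn_S i k) hτ' hle hs]
    exact h.motion i k s ⟨hs.1, hs.2.trans hle⟩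
  energy i k s hs := by
    rw [derivWithin_Icc_eq_derivWithin_Icc (h.contDiffOn_F i k) hτ' hle hs]
    exact h.energy i k s ⟨hs.1, hs.2.trans hle⟩
  defect_lower i k s hs := h.defect_lower i k s ⟨hs.1, hs.2.trans hle⟩
  defect_upper i k s hs := h.defect_upper i k s ⟨hs.1, hs.2.trans hle⟩

/-- **Enlarging the defect constants**: a `(κ₁, κ₂)`-pseudo-flow is a `(κ₁', κ₂')`-pseudo-flow for
`κ₁ ≤ κ₁'`, `κ₂ ≤ κ₂'` (`ε₀ > -1`; the energies are nonnegative, so the (4.10)-integral is). In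
particular an exact flow is an `(η, η)`-pseudo-flow for every `η ≥ 0`.
[cite: Tao2016AveragedNS, §4 Lemma 4.1 (4.8), (4.10)] -/
theorem pseudoFlowOnShift_of_le_defects (h : PseudoFlowOnShift 𝕊 τ ε₀ α κ₁ κ₂ S₀ F₀ B₀ S F) (hε : 0 < 1 + ε₀)
    {κ₁' κ₂' : ℝ} (h₁ : κ₁ ≤ κ₁') (h₂ : κ₂ ≤ κ₂') : PseudoFlowOnShift 𝕊 τ ε₀ α κ₁' κ₂' S₀ F₀ B₀ S F where
  contDiffOn_S := h.contDiffOn_S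
  contDiffOn_F := h.contDiffOn_F
  nonneg_F := h.nonneg_F
  apriori_S := h.apriori_S
  apriori_F := h.apriori_F
  init_S := h.init_S
  init_F := h.init_F
  motion i k s hs := by
    refine (h.motion i k s hs).trans ?_
    have hw : 0 ≤ (1 + ε₀) ^ ((2 : ℝ) * k) * Real.sqrt (F i k s) :=
      mul_nonneg (Real.rpow_pos_of_pos hε _).le (Real.sqrt_nonneg _)
    nlinarith
  energy := h.energy
  defect_lower := h.defect_lower
  defect_upper i k s hs := by
    refine (h.defect_upper i k s hs).trans ?_
    have hF : 0 ≤ ∫ u in (0 : ℝ)..s, F i k u :=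
      intervalIntegral.integral_nonneg hs.1 fun u hu => h.nonneg_F i k u ⟨hu.1, hu.2.trans hs.2⟩
    have hw : 0 ≤ (1 + ε₀) ^ ((2 : ℝ) * k) * ∫ u in (0 : ℝ)..s, F i k u :=
      mul_nonneg (Real.rpow_pos_of_pos hε _).le hF
    nlinarith

/-- **Uniform amplitude and energy bounds from (4.5)**: along a pseudo-flow (`ε₀ > -1`) there is
`M ≥ 0` with `|S_{i,k}(s)| ≤ M`, `|S_{i,k}(s)| ≤ M (1+ε₀)^{-10k}`, `√F_{i,k}(s) ≤ M` and
`√F_{i,k}(s) ≤ M (1+ε₀)^{-10k}` for all modes, shells and `s ∈ [0, τ]` (the constants of the two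
a priori fields merged). [cite: Tao2016AveragedNS, §4 Lemma 4.1 (4.5)] -/
theorem pseudoFlowOnShift_uniform_bounds (h : PseudoFlowOnShift 𝕊 τ ε₀ α κ₁ κ₂ S₀ F₀ B₀ S F) (hε : 0 < 1 + ε₀) :
    ∃ M : ℝ, 0 ≤ M ∧ ∀ s ∈ Icc 0 τ, ∀ (i : Fin m) (k : ℤ),
      |S i k s| ≤ M ∧ |S i k s| ≤ M * (1 + ε₀) ^ (-(10 : ℝ) * k) ∧
        Real.sqrt (F i k s) ≤ M ∧ Real.sqrt (F i k s) ≤ M * (1 + ε₀) ^ (-(10 : ℝ) * k) := by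
  obtain ⟨M₁, hM₁⟩ := h.apriori_S
  obtain ⟨M₂, hM₂⟩ := h.apriori_F
  refine ⟨max (max M₁ M₂) 0, le_max_right _ _, fun s hs i k => ?_⟩
  have hw : 0 ≤ 1 + (1 + ε₀) ^ ((10 : ℝ) * k) := by
    have := Real.rpow_pos_of_pos hε ((10 : ℝ) * k)
    linarith
  have hq : 0 < (1 + ε₀) ^ ((10 : ℝ) * k) := Real.rpow_pos_of_pos hε _
  have hneg : (1 + ε₀) ^ (-(10 : ℝ) * k) = ((1 + ε₀) ^ ((10 : ℝ) * k))⁻¹ := by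
    rw [show -(10 : ℝ) * k = -((10 : ℝ) * k) by ring, Real.rpow_neg hε.le]
  -- generic: weight bound ⇒ the two bounds
  have gen : ∀ x : ℝ, 0 ≤ x → (1 + (1 + ε₀) ^ ((10 : ℝ) * k)) * x ≤ max (max M₁ M₂) 0 →
      x ≤ max (max M₁ M₂) 0 ∧ x ≤ max (max M₁ M₂) 0 * (1 + ε₀) ^ (-(10 : ℝ) * k) := by
    intro x hx hb
    refine ⟨by nlinarith, ?_⟩
    rw [hneg, ← div_eq_mul_inv, le_div_iff₀ hq]
    nlinarith
  have hS := gen |S i k s| (abs_nonneg _) ((hM₁ s hs i k).trans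
    ((le_max_left _ _).trans (le_max_left _ _)))
  have hF := gen (Real.sqrt (F i k s)) (Real.sqrt_nonneg _) ((hM₂ s hs i k).trans
    ((le_max_right _ _).trans (le_max_left _ _)))
  exact ⟨hS.1, hS.2, hF.1, hF.2⟩

end GappedFrontRobustOn

end Summit.NavierStokesRegularity.NavierStokesRegularity.Theorems

end
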